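import Mathlib
import HarnessLib
import Summits.HubbardSuperconductivity.HubbardSuperconductivity.Theorems.KLProgrammeKLRegimeCountertermOneVolumeJT
import Summits.HubbardSuperconductivity.HubbardSuperconductivity.Theorems.KLProgrammeKLRegimeCountertermContinuationJS

/-!
# Route `KLProgramme` — child Counterterm of crux K3: THE ONE-VOLUME CONSTRUCTION WITH THE SELF-MAP SUPPLIED
# (seat hubbard-kl-k3c3-p2, «fixed point on FrameOK's tube»; twin of `…CountertermOneVolumeJT` — (E3a-MS) abstracted away)

`ct_oneVolume_thresholdsJT` (`…CountertermOneVolumeJT`) with the block of `…CountertermContinuationJS` (work file of this seat, filed alongside):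
the multi-slot clause is replaced by an ABSTRACT per-scale conjunct `X L M β U μ K n` and the admissibility of the smoothed Picard iterate is taken
from a SELF-MAP PROVIDER — a hypothesis with its own regime thresholds `c₄, U₄`:
`∀ c ≤ c₄, U ≤ U₄, β, μ, L, M, d: ∀ K admissible, ∀ n ≤ N, (∀ i ≤ n, X L M β U μ K i) → FrameOK (ctRenMs G) U N μ (ctIterJ L M d β U μ K n)`.
For today's text the provider is `frameOK_jackson_of_multiSlotFn'` under `ctRenMs_thresholds` (`X := TwoLegSizesMSFn … K.eval`); for a re-typed
multi-slot budget it is the matching instance of `frameOK_jackson_of_slotBudget` (p496425).  So a change of the (E3a-MS) text re-closes child 2 by: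
provider lemma + this theorem + the bundle one-liner — the continuation, the reading, the volume choice and the Jackson degree are untouched.

* `frameOK_zero_of_sums` — the zero frame is admissible under the three allowance sums (the induction's start, factored out);
* **`ct_oneVolume_thresholdsJS`** — thresholds `c₁, U₀`, ONE volume `(L₀, M₀)` past any `(Lh, Mh, M0)` with `CL n/L₀ ≤ ½·tol_n`, and at it: every
  block (any history `H`, the abstract `X`) yields an admissible `TrigPolyC4v` frame renormalised to HALF tolerance at every scale and real angle.
Proofs only; nothing is asserted about the Hubbard model.
-/

noncomputable section

namespace Summit.HubbardSuperconductivity.HubbardSuperconductivity.Theorems.KLRegimeSplit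

set_option linter.dupNamespace false -- summit = problem name (single-conjunct summit), D-0017

open Real Finset
open Literature.MathematicalPhysics.QuantumLattice Literature.Probability.LatticeModels
open Summit.HubbardSuperconductivity.HubbardSuperconductivity.Theorems.KLProgrammeLegKernels

/-! ## §1 The zero frame -/

/-- **The zero frame is admissible** on the window, given the three allowance sums of orders `≤ 2` (pieces all zero; `frameOK_of_pieces`). -/
theorem frameOK_zero_of_sums {R : RenConsts} (hR : ∀ j, 0 ≤ R.Gfr j) {U μ : ℝ} {N : ℕ} (hμ : μ ∈ Set.Icc (-1.05 : ℝ) (-0.15))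
    (h0 : ∑ m ∈ range (N + 1), R.Gfr 0 * uPow 0 U * (4 : ℝ) ^ (((0 : ℤ) - 2) * m) ≤ 3 / 80)
    (h1 : ∑ m ∈ range (N + 1), R.Gfr 1 * uPow 1 U * (4 : ℝ) ^ (((1 : ℤ) - 2) * m) ≤ 1 / 2000)
    (h2 : ∑ m ∈ range (N + 1), ∑ j ∈ range 3, R.Gfr j * uPow j U * (4 : ℝ) ^ (((j : ℤ) - 2) * m) ≤ 1 / 100) :
    FrameOK R U N μ (0 : TrigPolyC4v) := by
  refine frameOK_of_pieces hR hμ (K := 0) (Kp := fun _ => 0) (N := N) (fun p => by simp [eval_fsub]) ?_ h0 h1 h2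
  intro m _ j _ q
  rw [evalM_zero_eq, iteratedFDeriv_fun_zero]
  simp only [Pi.zero_apply, norm_zero]
  exact mul_nonneg (mul_nonneg (hR j) (uPow_nonneg j U)) (zpow_nonneg (by norm_num) _)

/-! ## §2 The thresholds of the one-volume construction, self-map supplied -/

/-- **THRESHOLDS AND THE VOLUME OF CHILD 2's CONSTRUCTION, SELF-MAP SUPPLIED.**  For `G, Q`, an abstract per-scale slot conjunct `X` and a
self-map PROVIDER for the package `ctRenMs G` (thresholds `c₄, U₄`; from the `X`-conjuncts at the scales `≤ n` of an admissible frame, the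
smoothed iterate `ctIterJ L M d β U μ K n` is admissible — at every volume and degree), there are `c₁ > 0` and `U₀(c) > 0` such that for
`0 < c ≤ c₁`, `0 < U ≤ U₀`, `klBetaMin ≤ β ≤ e^{c/U²}`, `μ ∈ klWindowC`, any thresholds `Lh, Mh, M0` and rates `CL n ≥ 0`: there is ONE volume
`(L₀, M₀)` past them with `CL n / L₀ ≤ ½·tol_n`, at which EVERY block (any history `H`; pieces symmetric `C⁴` with tier-1 sizes, (E3c-T), the
conjunct `X`, `Ren → H`) yields an admissible `TrigPolyC4v` frame whose local parts are within HALF the quadratic tolerance at every scale and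
every real angle. -/
theorem ct_oneVolume_thresholdsJS (G : GeoConsts) (Q : EngConsts) (hG : G.WF) (hQ : Q.WF)
    (X : ∀ (L M : ℕ) [NeZero L] [NeZero M], ℝ → ℝ → ℝ → TrigPolyC4v → ℕ → Prop)
    (hsmP : ∃ c₄ : ℝ, 0 < c₄ ∧ ∃ U₄ : ℝ, 0 < U₄ ∧ ∀ c U β : ℝ, 0 < c → c ≤ c₄ → 0 < U → U ≤ U₄ →
      klBetaMin ≤ β → β ≤ Real.exp (c / U ^ 2) → ∀ μ ∈ klWindowC, ∀ (L M : ℕ) [NeZero L] [NeZero M] (d : ℕ),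
        ∀ K : TrigPolyC4v, FrameOK (ctRenMs G) U (nScales β) μ K → ∀ n : ℕ, n ≤ nScales β →
          (∀ i ≤ n, X L M β U μ K i) → FrameOK (ctRenMs G) U (nScales β) μ (ctIterJ L M d β U μ K n)) :
    ∃ c₁ : ℝ, 0 < c₁ ∧ ∀ c : ℝ, 0 < c → c ≤ c₁ → ∃ U₀ : ℝ, 0 < U₀ ∧
      ∀ μ ∈ klWindowC, ∀ U : ℝ, 0 < U → U ≤ U₀ → ∀ β : ℝ, klBetaMin ≤ β → β ≤ Real.exp (c / U ^ 2) →
        ∀ (Lh : ℕ) (Mh M0 : ℕ → ℕ) (CL : ℕ → ℝ), (∀ n, 0 ≤ CL n) →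
          ∃ (L₀ M₀ : ℕ), 0 < L₀ ∧ 0 < M₀ ∧ Lh ≤ L₀ ∧ Mh L₀ ≤ M₀ ∧ M0 L₀ ≤ M₀ ∧
            (∀ n ≤ nScales β, CL n / L₀ ≤ ctCr G * |U| * klScale klE0 n ^ 2 / klE0 / 2) ∧
            ∀ (_ : NeZero L₀) (_ : NeZero M₀) (H : TrigPolyC4v → ℕ → Prop),
              (∀ K : TrigPolyC4v, FrameOK (ctRenMs G) U (nScales β) μ K → ∀ n : ℕ, n ≤ nScales β →
                (∀ j < n, RenormalisedAtF L₀ M₀ β U μ K (ctRenMs G) j) →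
                  (IsSymmetricFrame (klTwoLegPieceFn L₀ M₀ β U μ K.eval n) ∧
                    ContDiff ℝ 4 (onM (klTwoLegPieceFn L₀ M₀ β U μ K.eval n)) ∧
                    ∀ j ≤ 2, ∀ q : Momentum,
                      ‖iteratedFDeriv ℝ j (onM (klTwoLegPieceFn L₀ M₀ β U μ K.eval n)) q‖ ≤ twoLegBar G Q U j n) ∧
                    FrameLipschitzFnT L₀ M₀ H G Q (ctRenMs G) β U μ K n ∧ X L₀ M₀ β U μ K n ∧
                      (RenormalisedAtF L₀ M₀ β U μ K (ctRenMs G) n → H K n)) →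
              ∃ K : TrigPolyC4v, FrameOK (ctRenMs G) U (nScales β) μ K ∧
                ∀ n ≤ nScales β, ∀ θ : ℝ, |klLocalPart L₀ M₀ β U μ K n θ| ≤ ctCr G * |U| * klScale klE0 n ^ 2 / klE0 / 2 := by
  have hR : ∀ j, 0 ≤ (ctRenMs G).Gfr j := (ctRenMs_WF2 hG).1.2.2
  have hS0 : 0 ≤ G.S 0 := hG.2.2.2.2.2.2.2.2.2.2.2.2.2.2.2.2.2.1 0
  have hS'0 : 0 ≤ Q.S' 0 := hQ.2.2.2.2.1 0
  have hSL : 0 ≤ G.SL := hG.2.2.2.2.2.2.2.2.2.2.2.2.2.2.2.2.2.2.2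
  have hSL' : 0 ≤ Q.SL := hQ.2.2.2.2.2.2.1
  obtain ⟨c₂, hc₂, U₂, hU₂, thr⟩ := ctRenMs_thresholds (G := G) (Q := Q) hG hQ
  obtain ⟨c₃, hc₃, U₃, hU₃, read⟩ := klLocalPart_eq_partialSumFn_of_frameOK (ctRenMs G) hR
  obtain ⟨c₄, hc₄, U₄, hU₄, smp⟩ := hsmP
  refine ⟨min (min c₂ c₃) c₄, lt_min (lt_min hc₂ hc₃) hc₄, fun c hc hcle => ?_⟩
  have hcc₂ : c ≤ c₂ := hcle.trans ((min_le_left _ _).trans (min_le_left _ _))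
  have hcc₃ : c ≤ c₃ := hcle.trans ((min_le_left _ _).trans (min_le_right _ _))
  have hcc₄ : c ≤ c₄ := hcle.trans (min_le_right _ _)
  have hu₄pos : 0 < 1 / (10 * (Q.S' 0 + 1)) := by positivity
  have hu₅pos : 0 < 3 / (4000 * (G.SL + Q.SL + 1)) := by positivity
  refine ⟨min (min (min U₂ U₃) U₄) (min (min (1 / (10 * (Q.S' 0 + 1))) (3 / (4000 * (G.SL + Q.SL + 1)))) 1),
    lt_min (lt_min (lt_min hU₂ hU₃) hU₄) (lt_min (lt_min hu₄pos hu₅pos) one_pos), ?_⟩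
  intro μ hμ U hU hUle β hβ hβc Lh Mh M0 CL hCL
  have hU2 : U ≤ U₂ := hUle.trans ((min_le_left _ _).trans ((min_le_left _ _).trans (min_le_left _ _)))
  have hU3 : U ≤ U₃ := hUle.trans ((min_le_left _ _).trans ((min_le_left _ _).trans (min_le_right _ _)))
  have hU4' : U ≤ U₄ := hUle.trans ((min_le_left _ _).trans (min_le_right _ _))
  have hU4 : U ≤ 1 / (10 * (Q.S' 0 + 1)) := hUle.trans ((min_le_right _ _).trans ((min_le_left _ _).trans (min_le_left _ _)))
  have hU5 : U ≤ 3 / (4000 * (G.SL + Q.SL + 1)) :=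
    hUle.trans ((min_le_right _ _).trans ((min_le_left _ _).trans (min_le_right _ _)))
  have hU1 : U ≤ 1 := hUle.trans ((min_le_right _ _).trans (min_le_right _ _))
  have hS0' : Q.S' 0 * |U| ≤ 1 / 10 := sPrime_zero_mul_abs_le hS'0 hU hU4
  have hq : 4 / 3 * (G.SL + Q.SL * |U|) * |U| ≤ 1 / 1000 := contraction_le hSL hSL' hU hU1 hU5
  obtain ⟨-, -, h0, h1, h2⟩ := thr c U β hc.le hcc₂ hU hU2 hβ hβc
  have hμw : μ ∈ Set.Icc (-1.05 : ℝ) (-0.15) := hμ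
  have hzero : FrameOK (ctRenMs G) U (nScales β) μ (0 : TrigPolyC4v) := frameOK_zero_of_sums hR hμw h0 h1 h2
  -- the construction volume: only the rates `CL n / L₀ ≤ ½·tol_n` constrain it
  have htpos : ∀ n ≤ nScales β, 0 < ctCr G * |U| * klScale klE0 n ^ 2 / klE0 / 2 := by
    intro n _
    have hUa : 0 < |U| := abs_pos.2 hU.ne'
    have hcr0 : 0 < ctCr G := by unfold ctCr; positivity
    have he0 : (0 : ℝ) < klE0 := by norm_num [klE0]
    have hΛ : 0 < klScale klE0 n := by unfold klScale; positivity
    positivity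
  obtain ⟨L₀, hL₀pos, hL₀min, hL₀rate⟩ :=
    exists_volume_threshold (N := nScales β) (a := CL) (t := fun n => ctCr G * |U| * klScale klE0 n ^ 2 / klE0 / 2)
      (fun n _ => hCL n) htpos Lh
  have hM₀pos : 0 < max (Mh L₀) (M0 L₀) + 1 := Nat.succ_pos _
  refine ⟨L₀, max (Mh L₀) (M0 L₀) + 1, hL₀pos, hM₀pos, hL₀min, (le_max_left _ _).trans (Nat.le_succ _),
    (le_max_right _ _).trans (Nat.le_succ _), fun n hn => hL₀rate n hn, ?_⟩
  intro _ _ H blk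
  -- the Jackson degree `d`: one smallness condition on the displacement
  set qq : ℝ := 4 / 3 * (G.SL + Q.SL * |U|) * |U| with hqq
  set B1 : ℝ := ∑ i ∈ range (nScales β + 1), twoLegBar G Q U 1 i with hB1
  have hB1 : 0 ≤ B1 := sum_nonneg fun i _ => twoLegBar_nonneg' hG hQ U 1 i
  have hqq0 : 0 ≤ qq := by positivity
  set t : ℝ := |U| * ((16 : ℝ) ^ nScales β)⁻¹ / 256 with ht
  have htpos' : 0 < t := by have hUa : 0 < |U| := abs_pos.2 hU.ne'; positivity
  obtain ⟨d, hd⟩ := exists_nat_gt (π ^ 6 * B1 * ((1 + qq) * (1 + 2 * qq)) / t)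
  set η : ℝ := π ^ 6 / (d + 1) * B1 with hηdef
  have hdpos : (0 : ℝ) < d + 1 := by positivity
  have hη : π ^ 6 / (d + 1) * ∑ i ∈ range (nScales β + 1), twoLegBar G Q U 1 i ≤ η := le_rfl
  have hηw : ∀ m ≤ nScales β, (1 + qq) * (1 + 2 * qq) * η ≤ |U| * ((16 : ℝ) ^ m)⁻¹ / 256 := by
    intro m hm
    have hmono : t ≤ |U| * ((16 : ℝ) ^ m)⁻¹ / 256 := by
      rw [ht]
      have : ((16 : ℝ) ^ nScales β)⁻¹ ≤ ((16 : ℝ) ^ m)⁻¹ :=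
        inv_anti₀ (by positivity) (pow_le_pow_right₀ (by norm_num) hm)
      have hUa : 0 ≤ |U| := abs_nonneg U
      nlinarith
    have hkey : (1 + qq) * (1 + 2 * qq) * η ≤ t := by
      rw [hηdef]
      have hd' : π ^ 6 * B1 * ((1 + qq) * (1 + 2 * qq)) < t * d := by
        have := (div_lt_iff₀ htpos').1 hd
        linarith
      have hd1 : t * (d : ℝ) ≤ t * (d + 1) := by nlinarith
      rw [show (1 + qq) * (1 + 2 * qq) * (π ^ 6 / (d + 1) * B1) = π ^ 6 * B1 * ((1 + qq) * (1 + 2 * qq)) / (d + 1) by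
        field_simp]
      rw [div_le_iff₀ hdpos]
      linarith
    exact hkey.trans hmono
  -- the self-map at this volume and degree, from the provider
  have hsm : ∀ K : TrigPolyC4v, FrameOK (ctRenMs G) U (nScales β) μ K → ∀ n : ℕ, n ≤ nScales β →
      (∀ i ≤ n, X L₀ (max (Mh L₀) (M0 L₀) + 1) β U μ K i) →
        FrameOK (ctRenMs G) U (nScales β) μ (ctIterJ L₀ (max (Mh L₀) (M0 L₀) + 1) d β U μ K n) :=
    fun K hK n hn hX => smp c U β hc hcc₄ hU hU4' hβ hβc μ hμ L₀ (max (Mh L₀) (M0 L₀) + 1) d K hK n hn hX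
  -- the reading at the construction volume is EXACT
  have hread : ∀ K : TrigPolyC4v, FrameOK (ctRenMs G) U (nScales β) μ K → ∀ n : ℕ, n ≤ nScales β → ∀ B : ℝ,
      (∀ q : Fin 2 → ℝ, |K.eval q + ∑ i ∈ range (n + 1),
        klTwoLegPieceFn L₀ (max (Mh L₀) (M0 L₀) + 1) β U μ K.eval i q| ≤ B) →
        ∀ θ : ℝ, |klLocalPart L₀ (max (Mh L₀) (M0 L₀) + 1) β U μ K n θ| ≤ B := by
    intro K hK n _ B hB θ
    rw [read c hc hcc₃ U hU hU3 β hβ hβc μ hμ μ K hK L₀ (max (Mh L₀) (M0 L₀) + 1) n θ]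
    exact hB _
  exact ct_oneVolume_of_readingJES (L := L₀) (M := max (Mh L₀) (M0 L₀) + 1) hG hQ rfl blk hread hS0' hq hzero d hsm hη hηw

end Summit.HubbardSuperconductivity.HubbardSuperconductivity.Theorems.KLRegimeSplit

end
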